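import Mathlib
import HarnessLib
import Literature.Probability.MarkovChains.MetropolisHastings
import Literature.Probability.MarkovChains.TotalVariation

/-!
# The independence Metropolis–Hastings sampler converges at rate `1 − 1/w⋆`, and not faster
# (Mengersen–Tweedie 1996, Thm 2.1; Liu 1996; Wang 2022, Thm 2) — finite state space

The INDEPENDENCE sampler (independent Metropolis–Hastings, IMH) with target `p` and proposal
`q` proposes `y ∼ q` regardless of the current state `x` and accepts with probability
`min {1, w(y)/w(x)}`, `w = p/q`; on a finite state space it is the tree's Metropolis–Hastings
kernel with the constant proposal matrix, `mhKernel (fun _ y => q y) p`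
(`MetropolisHastings.lean`).  Write `w⋆ = sup_x p x / q x`; below `W` is any constant with
`p ≤ W · q` pointwise (so `w⋆ ≤ W`), and `W = w⋆` exactly when equality `p x⋆ = W · q x⋆` holds at
some state `x⋆`.

* Mengersen–Tweedie [cite: MengersenTweedie1996, Thm 2.1]: the IMH chain is uniformly ergodic
  iff it is geometrically ergodic iff `w⋆ < ∞`, and then `‖Pⁿ(x, ·) − π‖_TV ≤ (1 − 1/w⋆)ⁿ` for
  every start.  PROVED here in the finite-state form `imh_tvDist_lawAt_le` (every finite chain
  has `w⋆ < ∞`, so the content is the RATE): from any initial law `μ`,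
  `‖μPᵗ − p‖_TV ≤ (1 − 1/W)ᵗ · ‖μ − p‖_TV ≤ (1 − 1/W)ᵗ`.  The proof is the paper's: `q ≥ p/W`
  gives the whole-space (Doeblin) minorisation `P(x, ·) ≥ (1/W) · p(·)` (`imh_minorized`), and a
  minorised row-stochastic kernel contracts total variation by `1 − β` per step
  (`tvDist_stepLaw_le_of_minorized`, `tvDist_lawAt_le_of_minorized` = the whole-space-small
  bound [cite: MeynTweedie1993, Thm 16.2.4] with `m = 1`, `‖Pⁿ(x, ·) − π‖ ≤ 2ρⁿ`,
  `ρ = 1 − ν₁(X)`, in the half-`ℓ¹` normalisation of `TotalVariation.lean`, where the book's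
  factor `2` is `1`).
* Liu [cite: Liu1996IMH, Thm 2.1] computed the whole spectrum of the finite IMH matrix (second
  eigenvalue `1 − 1/w⋆`), and Wang [cite: Wang2022IMH, Thm 2 and Remark 1] showed the rate is
  EXACT: started at a state `x⋆` where `w` attains `w⋆`, `Pⁿ(x⋆, ·) = Rⁿ δ_{x⋆} + (1 − Rⁿ) π` with
  `R = 1 − 1/w⋆`.  PROVED here verbatim on a finite space: `imh_row_mode` (the row of the kernel
  at `x⋆` is `R δ_{x⋆} + (1/W) p`), `imh_lawAt_single_mode` (Wang's Remark-1 formula for every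
  `t`), and `imh_tvDist_lawAt_mode`: `‖δ_{x⋆}Pᵗ − p‖_TV = (1 − 1/W)ᵗ · (1 − p x⋆)` — on a finite
  space the point `x⋆` carries mass `p x⋆`, whence the factor `‖δ_{x⋆} − p‖_TV = 1 − p x⋆` in
  place of Wang's `1` for atomless `π`.

So `w⋆` IS the relaxation time of the exact flow-MCMC / IMH chain: with a model `q` that
under-weights some configuration by a factor `w⋆`, no start mixes faster than `(1 − 1/w⋆)ᵗ` from
the worst state, whatever the mean acceptance.  (Used by the venture `LatticeQCDFlow`, cell
pub-lqcd, as the typed form of its volume barrier for full-lattice independence samplers: for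
product laws `w⋆ = ∏ blocks w⋆_block`.)

-- TODO(general form): [cite: MengersenTweedie1996, Thm 2.1] is stated for a general state space
-- with densities w.r.t. a reference measure (uniform ⇔ geometric ergodicity ⇔ `ess sup p/q < ∞`);
-- the tree has no general-state Metropolis–Hastings `ProbabilityTheory.Kernel` yet, so only the
-- finite-state case (which is also Liu's setting) is typed here.  The converse direction
-- ("`w⋆ = ∞` ⇒ not geometrically ergodic") is vacuous on a finite space and is not stated.

All statements are over the tree's `mhKernel`, `stepLaw`, `lawAt`, `tvDist`, `IsRowStochastic`,
`IsStationary`; no new definitions.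
-/

namespace Literature.Probability.MarkovChains

open Finset

variable {X : Type*} [Fintype X] [DecidableEq X]

/-! ## Doeblin's whole-space minorisation contracts total variation -/

omit [DecidableEq X] in
/-- **Doeblin contraction (one step)** — the `m = 1` step of [cite: MeynTweedie1993, Thm 16.2.4]
(proof, eqs. (16.22)–(16.23): under the minorisation the chain "forgets" its state with
probability `1 − ρ` per step), in matrix form: if a row-stochastic kernel dominates a fixed
probability vector, `P x y ≥ β · ν y` for all `x, y` (`Σ ν = 1`), then for two vectors of equal
mass `‖μP − μ'P‖_TV ≤ (1 − β) · ‖μ − μ'‖_TV`.  (Proof here without coupling: subtract the common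
component `β ν`, which the equal masses cancel, and use `Σ_y (P x y − β ν y) = 1 − β`.) -/
theorem tvDist_stepLaw_le_of_minorized {P : X → X → ℝ} (hP : IsRowStochastic P) {ν : X → ℝ}
    {β : ℝ} (hν1 : ∑ y, ν y = 1) (hmin : ∀ x y, β * ν y ≤ P x y) {μ μ' : X → ℝ}
    (hmass : ∑ x, μ x = ∑ x, μ' x) :
    tvDist (stepLaw P μ) (stepLaw P μ') ≤ (1 - β) * tvDist μ μ' := by
  have hrow : ∀ x, ∑ y, (P x y - β * ν y) = 1 - β := fun x => by
    rw [sum_sub_distrib, hP.2 x, ← mul_sum, hν1, mul_one]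
  have hstep : ∀ y, stepLaw P μ y - stepLaw P μ' y = ∑ x, (μ x - μ' x) * (P x y - β * ν y) := by
    intro y
    have h0 : ∑ x, (μ x - μ' x) * (β * ν y) = 0 := by
      rw [← sum_mul, sum_sub_distrib, hmass, sub_self, zero_mul]
    unfold stepLaw
    rw [← sum_sub_distrib, ← sub_zero (∑ x, (μ x * P x y - μ' x * P x y)), ← h0,
      ← sum_sub_distrib]
    exact sum_congr rfl fun x _ => by ring
  have key : ∑ y, |stepLaw P μ y - stepLaw P μ' y| ≤ (1 - β) * ∑ x, |μ x - μ' x| :=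
    calc ∑ y, |stepLaw P μ y - stepLaw P μ' y|
        = ∑ y, |∑ x, (μ x - μ' x) * (P x y - β * ν y)| := sum_congr rfl fun y _ => by rw [hstep]
      _ ≤ ∑ y, ∑ x, |μ x - μ' x| * (P x y - β * ν y) := by
          refine sum_le_sum fun y _ => (abs_sum_le_sum_abs _ _).trans (le_of_eq ?_)
          exact sum_congr rfl fun x _ => by
            rw [abs_mul, abs_of_nonneg (sub_nonneg.2 (hmin x y))]
      _ = ∑ x, |μ x - μ' x| * ∑ y, (P x y - β * ν y) := by
          rw [sum_comm]; exact sum_congr rfl fun x _ => by rw [mul_sum]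
      _ = (1 - β) * ∑ x, |μ x - μ' x| := by
          rw [mul_comm, sum_mul]; exact sum_congr rfl fun x _ => by rw [hrow x]
  unfold tvDist
  calc 1 / 2 * ∑ y, |stepLaw P μ y - stepLaw P μ' y| ≤ 1 / 2 * ((1 - β) * ∑ x, |μ x - μ' x|) :=
        mul_le_mul_of_nonneg_left key (by norm_num)
    _ = (1 - β) * (1 / 2 * ∑ x, |μ x - μ' x|) := by ring

omit [DecidableEq X] in
/-- **Uniform ergodicity when the whole space is small** [cite: MeynTweedie1993, Thm 16.2.4]
(case `m = 1`: `P(x, A) ≥ ν₁(A)` for all `x` gives `‖Pⁿ(x, ·) − π‖ ≤ 2ρⁿ`, `ρ = 1 − ν₁(X)`; here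
`ν₁ = β · ν` with `ν` a probability vector, so `ρ = 1 − β`, the book's total-variation NORM is
twice the `tvDist` of `TotalVariation.lean`, and the start is any probability vector `μ` rather
than a point `x`, with the factor `‖μ − π‖_TV ≤ 1` kept explicit): for a row-stochastic `P` with
`P x y ≥ β · ν y`, a stationary probability vector `π` and an initial probability vector `μ`,
`‖μPᵗ − π‖_TV ≤ (1 − β)ᵗ · ‖μ − π‖_TV`. -/
theorem tvDist_lawAt_le_of_minorized {P : X → X → ℝ} (hP : IsRowStochastic P) {π ν : X → ℝ}
    {β : ℝ} (hπ : IsStationary π P) (hπ1 : ∑ x, π x = 1) (hν1 : ∑ y, ν y = 1)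
    (hmin : ∀ x y, β * ν y ≤ P x y) {μ : X → ℝ} (hμ1 : ∑ x, μ x = 1) (t : ℕ) :
    tvDist (lawAt P μ t) π ≤ (1 - β) ^ t * tvDist μ π := by
  have hβ : 0 ≤ 1 - β := by
    obtain ⟨x, -⟩ := nonempty_of_sum_ne_zero (s := (univ : Finset X)) (f := ν)
      (by rw [hν1]; exact one_ne_zero)
    have h1 : β = ∑ y, β * ν y := by rw [← mul_sum, hν1, mul_one]
    have h2 : ∑ y, β * ν y ≤ ∑ y, P x y := sum_le_sum fun y _ => hmin x y
    rw [hP.2 x] at h2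
    linarith
  induction t with
  | zero => simp [lawAt_zero]
  | succ t ih =>
    have hmass : ∑ x, lawAt P μ t x = ∑ x, π x := by rw [sum_lawAt hP, hμ1, hπ1]
    rw [lawAt_succ]
    conv_lhs => rw [← stepLaw_eq_self_of_isStationary hπ]
    calc tvDist (stepLaw P (lawAt P μ t)) (stepLaw P π)
        ≤ (1 - β) * tvDist (lawAt P μ t) π := tvDist_stepLaw_le_of_minorized hP hν1 hmin hmass
      _ ≤ (1 - β) * ((1 - β) ^ t * tvDist μ π) := mul_le_mul_of_nonneg_left ih hβ
      _ = (1 - β) ^ (t + 1) * tvDist μ π := by ring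

/-! ## The independence sampler: minorisation by the target, rate `1 − 1/W` -/

section IMH

variable {p q : X → ℝ} {W : ℝ}

omit [Fintype X] [DecidableEq X] in
/-- A weight bound `p ≤ W · q` with `p > 0`, `q ≥ 0` forces `W > 0` (private helper).
[folklore] -/
private theorem imh_weightBound_pos (hp : ∀ x, 0 < p x) (hq : ∀ x, 0 ≤ q x) (hW : ∀ x, p x ≤ W * q x)
    (x : X) : 0 < W :=
  pos_of_mul_pos_left ((hp x).trans_le (hW x)) (hq x)

omit [DecidableEq X] in
/-- A weight bound `p ≤ W · q` between probability vectors forces `W ≥ 1` (private helper).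
[folklore] -/
private theorem imh_one_le_weightBound (hp1 : ∑ x, p x = 1) (hq1 : ∑ x, q x = 1)
    (hW : ∀ x, p x ≤ W * q x) : 1 ≤ W := by
  have h : ∑ x, p x ≤ ∑ x, W * q x := sum_le_sum fun x _ => hW x
  rwa [hp1, ← mul_sum, hq1, mul_one] at h

/-- **The independence sampler is minorised by its target** (the step in the proof of
[cite: MengersenTweedie1996, Thm 2.1]): if `p ≤ W · q` pointwise then every row of the IMH
kernel dominates `p / W`, diagonal included: `P x y ≥ p y / W`. -/
theorem imh_minorized (hp : ∀ x, 0 < p x) (hq : ∀ x, 0 ≤ q x) (hq1 : ∑ x, q x = 1)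
    (hW : ∀ x, p x ≤ W * q x) (x y : X) :
    W⁻¹ * p y ≤ mhKernel (fun _ z => q z) p x y := by
  have hW0 : 0 < W := imh_weightBound_pos hp hq hW x
  have hle : ∀ z, W⁻¹ * p z ≤ q z := fun z => by
    rw [inv_mul_le_iff₀ hW0]; exact hW z
  by_cases hxy : y = x
  · subst hxy
    rw [mhKernel_self]
    have hsum : ∑ z ∈ univ.erase y, mhRate (fun _ z => q z) p y z ≤ ∑ z ∈ univ.erase y, q z :=
      sum_le_sum fun z _ => mhRate_le _ _ _ _
    have hq' : ∑ z ∈ univ.erase y, q z = 1 - q y := by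
      rw [sum_erase_eq_sub (mem_univ y), hq1]
    linarith [hle y]
  · rw [mhKernel_of_ne hxy, mhRate]
    refine le_min (hle y) ?_
    rw [le_div_iff₀ (hp x)]
    have hx := hle x
    nlinarith [hp y]

/-- **Mengersen–Tweedie: the independence sampler converges geometrically at rate `1 − 1/W`
from every initial law** [cite: MengersenTweedie1996, Thm 2.1] (finite-state form; the bound
`‖Pⁿ(x, ·) − π‖ ≤ (1 − β)ⁿ` of the theorem with `β = 1/W`, here with the extra factor
`‖μ − p‖_TV ≤ 1` kept): for probability vectors `p > 0`, `q ≥ 0` with `p ≤ W · q` and any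
initial probability vector `μ`, `‖μPᵗ − p‖_TV ≤ (1 − 1/W)ᵗ · ‖μ − p‖_TV`. -/
theorem imh_tvDist_lawAt_le_mul (hp : ∀ x, 0 < p x) (hp1 : ∑ x, p x = 1) (hq : ∀ x, 0 ≤ q x)
    (hq1 : ∑ x, q x = 1) (hW : ∀ x, p x ≤ W * q x) {μ : X → ℝ} (hμ1 : ∑ x, μ x = 1) (t : ℕ) :
    tvDist (lawAt (mhKernel (fun _ z => q z) p) μ t) p ≤ (1 - W⁻¹) ^ t * tvDist μ p := by
  have hP : IsRowStochastic (mhKernel (fun _ z => q z) p) :=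
    mhKernel_isRowStochastic (fun _ z => hq z) (fun _ => hq1.le) hp
  have hmin := imh_minorized hp hq hq1 hW
  exact tvDist_lawAt_le_of_minorized hP (mhKernel_isStationary hp _) hp1 hp1
    (fun x y => hmin x y) hμ1 t

/-- **Mengersen–Tweedie, as printed** [cite: MengersenTweedie1996, Thm 2.1] (finite-state form):
`‖μPᵗ − p‖_TV ≤ (1 − 1/W)ᵗ` for every initial probability vector `μ` — the IMH chain with
`sup p/q ≤ W` is uniformly ergodic with rate `1 − 1/W`. -/
theorem imh_tvDist_lawAt_le (hp : ∀ x, 0 < p x) (hp1 : ∑ x, p x = 1) (hq : ∀ x, 0 ≤ q x)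
    (hq1 : ∑ x, q x = 1) (hW : ∀ x, p x ≤ W * q x) {μ : X → ℝ} (hμ : ∀ x, 0 ≤ μ x)
    (hμ1 : ∑ x, μ x = 1) (t : ℕ) :
    tvDist (lawAt (mhKernel (fun _ z => q z) p) μ t) p ≤ (1 - W⁻¹) ^ t := by
  have h1 : tvDist μ p ≤ 1 := tvDist_le_one hμ (fun x => (hp x).le) hμ1 hp1
  have hβ : 0 ≤ 1 - W⁻¹ :=
    sub_nonneg.2 (inv_le_one_of_one_le₀ (imh_one_le_weightBound hp1 hq1 hW))
  calc tvDist (lawAt (mhKernel (fun _ z => q z) p) μ t) p ≤ (1 - W⁻¹) ^ t * tvDist μ p :=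
        imh_tvDist_lawAt_le_mul hp hp1 hq hq1 hW hμ1 t
    _ ≤ (1 - W⁻¹) ^ t * 1 := mul_le_mul_of_nonneg_left h1 (pow_nonneg hβ t)
    _ = (1 - W⁻¹) ^ t := mul_one _

/-! ## The rate is exact: the chain started at the mode of `w = p/q` (Liu 1996; Wang 2022) -/

/-- **The IMH row at the mode** [cite: Wang2022IMH, Remark 1] (`P(x⋆, ·) = R δ_{x⋆} + π/w⋆`;
the computation behind [cite: Liu1996IMH, Thm 2.1]): if `p ≤ W · q` with equality at `x⋆`, then
`P x⋆ y = (1 − 1/W) · δ_{x⋆}(y) + p y / W` — every proposal `y ≠ x⋆` is accepted with probability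
`w(y)/w⋆`. -/
theorem imh_row_mode (hp : ∀ x, 0 < p x) (hp1 : ∑ x, p x = 1) (hq : ∀ x, 0 ≤ q x)
    (hW : ∀ x, p x ≤ W * q x) {xs : X} (hxs : p xs = W * q xs) (y : X) :
    mhKernel (fun _ z => q z) p xs y =
      (1 - W⁻¹) * (Pi.single xs (1 : ℝ) : X → ℝ) y + W⁻¹ * p y := by
  have hW0 : 0 < W := imh_weightBound_pos hp hq hW xs
  have hqs : q xs ≠ 0 := fun h => by
    have := hp xs; rw [hxs, h, mul_zero] at this; exact lt_irrefl _ this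
  have hoff : ∀ z, z ≠ xs → mhRate (fun _ z => q z) p xs z = W⁻¹ * p z := by
    intro z _
    rw [mhRate]
    have h2 : p z * q xs / p xs = W⁻¹ * p z := by
      rw [hxs]; field_simp
    rw [h2]
    exact min_eq_right (by rw [inv_mul_le_iff₀ hW0]; exact hW z)
  by_cases hy : y = xs
  · subst hy
    rw [mhKernel_self, Pi.single_eq_same,
      sum_congr rfl fun z hz => hoff z (ne_of_mem_erase hz), ← mul_sum,
      sum_erase_eq_sub (mem_univ _), hp1]
    ring
  · rw [mhKernel_of_ne hy, hoff y hy, Pi.single_eq_of_ne hy]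
    ring

/-- **Wang's exact law from the mode** [cite: Wang2022IMH, Remark 1]
(`Pⁿ(x⋆, ·) = Rⁿ δ_{x⋆} + (1 − Rⁿ) π`, `R = 1 − 1/w⋆`): for `p ≤ W · q` with equality at `x⋆`,
the IMH chain started at `x⋆` has law `(1 − 1/W)ᵗ · δ_{x⋆} + (1 − (1 − 1/W)ᵗ) · p` at every time
`t` (induction: the row identity `imh_row_mode` and stationarity of `p`). -/
theorem imh_lawAt_single_mode (hp : ∀ x, 0 < p x) (hp1 : ∑ x, p x = 1) (hq : ∀ x, 0 ≤ q x)
    (hW : ∀ x, p x ≤ W * q x) {xs : X} (hxs : p xs = W * q xs) (t : ℕ) :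
    lawAt (mhKernel (fun _ z => q z) p) (Pi.single xs 1) t =
      fun y => (1 - W⁻¹) ^ t * (Pi.single xs (1 : ℝ) : X → ℝ) y + (1 - (1 - W⁻¹) ^ t) * p y := by
  induction t with
  | zero => funext y; simp [lawAt_zero]
  | succ t ih =>
    rw [lawAt_succ, ih]
    funext y
    unfold stepLaw
    have hstat : ∑ x, p x * mhKernel (fun _ z => q z) p x y = p y := mhKernel_isStationary hp _ y
    have hδ : ∑ x, (Pi.single xs (1 : ℝ) : X → ℝ) x * mhKernel (fun _ z => q z) p x y =
        mhKernel (fun _ z => q z) p xs y := by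
      rw [sum_eq_single xs (fun b _ hb => by rw [Pi.single_eq_of_ne hb, zero_mul])
        (fun h => absurd (mem_univ xs) h), Pi.single_eq_same, one_mul]
    simp_rw [add_mul, sum_add_distrib, mul_assoc, ← mul_sum, hδ, hstat,
      imh_row_mode hp hp1 hq hW hxs y]
    ring

/-- **The Mengersen–Tweedie rate is attained** [cite: Wang2022IMH, Thm 2] (finite-state form;
cf. [cite: Liu1996IMH, Thm 2.1]: second eigenvalue `1 − 1/w⋆`): for `p ≤ W · q` with equality at
`x⋆`, `‖δ_{x⋆}Pᵗ − p‖_TV = (1 − 1/W)ᵗ · (1 − p x⋆)` exactly — on a finite space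
`‖δ_{x⋆} − p‖_TV = 1 − p x⋆` replaces Wang's `1` (atomless `π`).  With `imh_tvDist_lawAt_le`:
the relaxation time of the IMH chain is `w⋆ = max p/q`, neither more nor less. -/
theorem imh_tvDist_lawAt_mode (hp : ∀ x, 0 < p x) (hp1 : ∑ x, p x = 1) (hq : ∀ x, 0 ≤ q x)
    (hq1 : ∑ x, q x = 1) (hW : ∀ x, p x ≤ W * q x) {xs : X} (hxs : p xs = W * q xs) (t : ℕ) :
    tvDist (lawAt (mhKernel (fun _ z => q z) p) (Pi.single xs 1) t) p =
      (1 - W⁻¹) ^ t * (1 - p xs) := by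
  rw [imh_lawAt_single_mode hp hp1 hq hW hxs t]
  have hR : 0 ≤ 1 - W⁻¹ :=
    sub_nonneg.2 (inv_le_one_of_one_le₀ (imh_one_le_weightBound hp1 hq1 hW))
  have h1 : ∀ y, |(1 - W⁻¹) ^ t * (Pi.single xs (1 : ℝ) : X → ℝ) y +
      (1 - (1 - W⁻¹) ^ t) * p y - p y| =
      (1 - W⁻¹) ^ t * |(Pi.single xs (1 : ℝ) : X → ℝ) y - p y| := fun y => by
    rw [show (1 - W⁻¹) ^ t * (Pi.single xs (1 : ℝ) : X → ℝ) y + (1 - (1 - W⁻¹) ^ t) * p y - p y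
        = (1 - W⁻¹) ^ t * ((Pi.single xs (1 : ℝ) : X → ℝ) y - p y) by ring,
      abs_mul, abs_of_nonneg (pow_nonneg hR t)]
  have hps : p xs ≤ 1 := by
    rw [← hp1]; exact single_le_sum (fun y _ => (hp y).le) (mem_univ xs)
  have h2 : ∑ y, |(Pi.single xs (1 : ℝ) : X → ℝ) y - p y| = 2 * (1 - p xs) := by
    rw [← add_sum_erase _ _ (mem_univ xs), Pi.single_eq_same,
      sum_congr rfl fun y hy => by
        rw [Pi.single_eq_of_ne (ne_of_mem_erase hy), zero_sub, abs_neg, abs_of_pos (hp y)],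
      sum_erase_eq_sub (mem_univ xs), hp1, abs_of_nonneg (by linarith)]
    ring
  unfold tvDist
  simp_rw [h1]
  rw [← mul_sum, h2]
  ring

end IMH

end Literature.Probability.MarkovChains
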